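/-
Copyright (c) 2026. All rights reserved.
Released under Apache 2.0 license as described in the file LICENSE.
-/
import Literature.NumberTheory.Automorphic.EichlerOrdersTypeFibres
import Literature.NumberTheory.Automorphic.BrandtMatrixRamifiedEigenspaces
import HarnessLib

/-!
# The Atkin–Lehner-invariant part of the Brandt module of an Eichler order: the functions on `Cls O` invariant under all
# `W_{q⁻}`, `W_{p⁺}` are the functions of the type, `v = g ∘ typeOf`, a Hecke-stable subspace of dimension `#Typ O`
# (Voight Prop. 18.5.10 + (23.4.20); Vignéras III §5 ex. 5.8)

[tag: quaternion_algebra] [tag: eichler_order] [tag: hecke_operator]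

Topic `NumberTheory/Automorphic`; THEOREMS ONLY (no definition, no named fact, no instance; net Literature debt `0`).
Lane `lit-hodgefound`, seat p12, gen 51 — the every-level form of `dim E₊(T(p)) = #Typ O` (type `(1,p)`,
`DefiniteMaximalOrdersRamifiedInvolutionEigenspaces.lean`). For EVERY Brandt setup `S` of type `(N⁺, N⁻)`:

* §1 **`XiSetup.atkinLehnerInvariant_iff_exists_comp_typeOf`**: a function `v` on `Cls O` (values anywhere) satisfies
  `v ∘ W_{q⁻} = v` (`q ∣ N⁻`) and `v ∘ W_{p⁺} = v` (`p ∤ N⁻`) iff `v = g ∘ typeOf` for a function `g` on `Typ O` — the fibres of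
  the type map are the orbits of the involutions (`EichlerOrdersTypeFibres.lean`);
* §2 on the Brandt module `ℚ^{Cls O}`: the invariant functions form the range of the injective linear map `g ↦ g ∘ typeOf`
  (`LinearMap.funLeft ℚ ℚ (typeOf S.O)`), **of dimension `#Typ O`** (`finrank_range_funLeft_typeOf`), **stable under every Brandt
  matrix `T(n)`** (`mapsTo_toLin_matrix_range_funLeft_typeOf`, from `T(n)_{W c, W c'} = T(n)_{c c'}`,
  `BrandtSetupAtkinLehnerHecke.lean`), contained in every `E₊(T(q))`, `q ∣ N⁻` (`range_funLeft_typeOf_le_eigenspace_one`);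
* §3 maximal orders (`N⁺ = 1`, squarefree `N⁻`): **`⨅_{q ∣ N⁻} E₊(T(q)) = {g ∘ typeOf}`**, so
  **`dim ⨅_{q ∣ N⁻} E₊(T(q)) = #Typ O`** (`iInf_eigenspace_one_eq_range_funLeft_typeOf`, `finrank_iInf_eigenspace_one`).

## References

* [Voight2021] J. Voight, *Quaternion Algebras*, GTM 288 (2021): Prop. 18.5.10, (23.4.20), Cor. 18.5.12, 41.3.4–(41.3.5).
* [VignerasLNM800] M.-F. Vignéras, *Arithmétique des algèbres de quaternions*, LNM 800 (1980), Ch. III §5 exercice 5.8 (b)–(d).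

## Scope (honest)

Theorems only. The joint `±`-eigenspace decomposition under all the involutions (Atkin–Lehner signs) is not made here; only
its all-`+` part is identified.
-/

noncomputable section

open scoped Pointwise Matrix

namespace Literature.NumberTheory.Automorphic

namespace Brandt

variable {Nplus Nminus : ℕ} (S : XiSetup Nplus Nminus)

/-! ## §1 Invariant functions are the functions of the type -/

/-- **A function on `Cls O` is invariant under all the Atkin–Lehner involutions `W_{q⁻}` (`q ∣ N⁻`), `W_{p⁺}` (`p ∤ N⁻`)
iff it factors through the type map**, `v = g ∘ typeOf` (every Brandt setup; the fibres of `typeOf` are the orbits of the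
involutions). [cite: Voight2021, Prop. 18.5.10 and (23.4.20)] [cite: VignerasLNM800, Ch. III §5 exercice 5.8 (c)] -/
theorem XiSetup.atkinLehnerInvariant_iff_exists_comp_typeOf {X : Type*} (v : ClassSet S.O → X) :
    ((∀ (q : ℕ) (_ : Fact q.Prime) (hq : q ∣ Nminus) (c : ClassSet S.O), v (S.wMinus q hq c) = v c) ∧
        ∀ (p : ℕ) (_ : Fact p.Prime) (hp : ¬ p ∣ Nminus) (c : ClassSet S.O), v (S.wPlus p hp c) = v c) ↔
      ∃ g : TypeSet S.O → X, v = g ∘ typeOf S.O := by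
  constructor
  · rintro ⟨hM, hP⟩
    -- along a chain of involutions the value of `v` is constant
    have key : ∀ a b : ClassSet S.O, Relation.ReflTransGen
        (fun a b : ClassSet S.O =>
          (∃ (q : ℕ) (_ : Fact q.Prime) (hq : q ∣ Nminus), S.wMinus q hq a = b) ∨
            (∃ (p : ℕ) (_ : Fact p.Prime) (hp : ¬ p ∣ Nminus), S.wPlus p hp a = b)) a b → v b = v a := by
      intro a b hab
      induction hab with
      | refl => rfl
      | tail _ hbc ih =>
        rcases hbc with ⟨q, hf, hq, rfl⟩ | ⟨p, hf, hp, rfl⟩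
        · rw [hM q hf hq, ih]
        · rw [hP p hf hp, ih]
    have hfib : ∀ c c' : ClassSet S.O, typeOf S.O c = typeOf S.O c' → v c = v c' := fun c c' h =>
      key c' c (S.typeOf_eq_typeOf_iff_reflTransGen_atkinLehner.mp h)
    refine ⟨fun τ => Quotient.liftOn τ v fun c c' h => hfib c c' (Quotient.sound h), funext fun c => ?_⟩
    rfl
  · rintro ⟨g, rfl⟩
    exact ⟨fun q _ hq c => congrArg g (S.typeOf_wMinus hq c), fun p _ hp c => congrArg g (S.typeOf_wPlus hp c)⟩

/-- One direction separately: the functions of the type are invariant. [cite: Voight2021, Remark 17.4.15] -/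
theorem XiSetup.comp_typeOf_atkinLehnerInvariant {X : Type*} (g : TypeSet S.O → X) :
    (∀ (q : ℕ) (_ : Fact q.Prime) (hq : q ∣ Nminus) (c : ClassSet S.O), (g ∘ typeOf S.O) (S.wMinus q hq c) = (g ∘ typeOf S.O) c) ∧
      ∀ (p : ℕ) (_ : Fact p.Prime) (hp : ¬ p ∣ Nminus) (c : ClassSet S.O), (g ∘ typeOf S.O) (S.wPlus p hp c) = (g ∘ typeOf S.O) c :=
  (S.atkinLehnerInvariant_iff_exists_comp_typeOf _).mpr ⟨g, rfl⟩

/-! ## §2 The invariant part of the Brandt module `ℚ^{Cls O}` -/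

section Module

variable [Fintype (ClassSet S.O)] [DecidableEq (ClassSet S.O)]

omit [Fintype (ClassSet S.O)] [DecidableEq (ClassSet S.O)] in
/-- **The invariant functions are the range of `g ↦ g ∘ typeOf`.** [cite: Voight2021, Prop. 18.5.10 and (23.4.20)] -/
theorem XiSetup.atkinLehnerInvariant_iff_mem_range_funLeft (v : ClassSet S.O → ℚ) :
    ((∀ (q : ℕ) (_ : Fact q.Prime) (hq : q ∣ Nminus) (c : ClassSet S.O), v (S.wMinus q hq c) = v c) ∧
        ∀ (p : ℕ) (_ : Fact p.Prime) (hp : ¬ p ∣ Nminus) (c : ClassSet S.O), v (S.wPlus p hp c) = v c) ↔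
      v ∈ LinearMap.range (LinearMap.funLeft ℚ ℚ (typeOf S.O)) := by
  rw [S.atkinLehnerInvariant_iff_exists_comp_typeOf, LinearMap.mem_range]
  constructor
  · rintro ⟨g, rfl⟩
    exact ⟨g, rfl⟩
  · rintro ⟨g, rfl⟩
    exact ⟨g, rfl⟩

omit [Fintype (ClassSet S.O)] [DecidableEq (ClassSet S.O)] in
/-- `g ↦ g ∘ typeOf` is injective (`typeOf` is onto). [cite: Voight2021, Lemma 17.4.13] -/
theorem XiSetup.funLeft_typeOf_injective : Function.Injective (LinearMap.funLeft ℚ ℚ (typeOf S.O)) :=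
  LinearMap.funLeft_injective_of_surjective _ _ _ typeOf_surjective

omit [Fintype (ClassSet S.O)] [DecidableEq (ClassSet S.O)] in
/-- **The Atkin–Lehner-invariant part of the Brandt module has dimension the type number `#Typ O`** (every Eichler order
of a definite quaternion algebra over `ℚ`). [cite: Voight2021, Cor. 18.5.12 and (23.4.20)] [cite: VignerasLNM800, Ch. III §5 exercice 5.8 (c)] -/
theorem XiSetup.finrank_range_funLeft_typeOf :
    Module.finrank ℚ (LinearMap.range (LinearMap.funLeft ℚ ℚ (typeOf S.O))) = Nat.card (TypeSet S.O) := by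
  haveI : Finite (TypeSet S.O) := S.finite_typeSet
  letI : Fintype (TypeSet S.O) := Fintype.ofFinite _
  rw [LinearMap.finrank_range_of_inj S.funLeft_typeOf_injective, Module.finrank_fintype_fun_eq_card,
    Nat.card_eq_fintype_card]

omit [DecidableEq (ClassSet S.O)] in
/-- Reindexing a Hecke sum along an involution `W` with `T(n)_{W c, W d} = T(n)_{c d}` (rational coefficients). [cite: VignerasLNM800, Ch. III §5 exercice 5.8 (d)] -/
private theorem map_mulVec_comp_of_involutive {W : ClassSet S.O → ClassSet S.O} (hW : Function.Involutive W) (n : ℕ)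
    (hTW : ∀ c d, matrix S.O n (W c) (W d) = matrix S.O n c d) (v : ClassSet S.O → ℚ) :
    (matrix S.O n).map (Int.cast : ℤ → ℚ) *ᵥ (v ∘ W) = ((matrix S.O n).map (Int.cast : ℤ → ℚ) *ᵥ v) ∘ W := by
  funext c
  simp only [Matrix.mulVec, dotProduct, Function.comp_apply, Matrix.map_apply]
  have h1 : ∑ d, ((matrix S.O n (W c) (W d) : ℤ) : ℚ) * v (W d) = ∑ d, ((matrix S.O n (W c) d : ℤ) : ℚ) * v d :=
    Fintype.sum_bijective W hW.bijective (fun d => ((matrix S.O n (W c) (W d) : ℤ) : ℚ) * v (W d))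
      (fun d => ((matrix S.O n (W c) d : ℤ) : ℚ) * v d) fun _ => rfl
  rw [← h1]
  exact Finset.sum_congr rfl fun d _ => by rw [hTW]

omit [DecidableEq (ClassSet S.O)] in
/-- `T(n) (v ∘ W_{q⁻}) = (T(n) v) ∘ W_{q⁻}` on `ℚ^{Cls O}`. [cite: VignerasLNM800, Ch. III §5 exercice 5.8 (d)] -/
theorem XiSetup.map_mulVec_comp_wMinus {q : ℕ} [Fact q.Prime] (hq : q ∣ Nminus) (n : ℕ) (v : ClassSet S.O → ℚ) :
    (matrix S.O n).map (Int.cast : ℤ → ℚ) *ᵥ (v ∘ S.wMinus q hq) = ((matrix S.O n).map (Int.cast : ℤ → ℚ) *ᵥ v) ∘ S.wMinus q hq :=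
  map_mulVec_comp_of_involutive S (S.involutive_wMinus hq) n (fun c d => S.matrix_apply_wMinus_wMinus hq n c d) v

omit [DecidableEq (ClassSet S.O)] in
/-- `T(n) (v ∘ W_{p⁺}) = (T(n) v) ∘ W_{p⁺}` on `ℚ^{Cls O}`. [cite: Voight2021, (41.3.5)] -/
theorem XiSetup.map_mulVec_comp_wPlus {p : ℕ} [Fact p.Prime] (hp : ¬ p ∣ Nminus) (n : ℕ) (v : ClassSet S.O → ℚ) :
    (matrix S.O n).map (Int.cast : ℤ → ℚ) *ᵥ (v ∘ S.wPlus p hp) = ((matrix S.O n).map (Int.cast : ℤ → ℚ) *ᵥ v) ∘ S.wPlus p hp :=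
  map_mulVec_comp_of_involutive S (S.involutive_wPlus hp) n (fun c d => S.matrix_apply_wPlus_wPlus hp n c d) v

omit [DecidableEq (ClassSet S.O)] in
/-- **`T(n)` preserves the invariant functions**: if `v` is invariant under all `W_{q⁻}`, `W_{p⁺}` then so is `T(n) v`.
[cite: VignerasLNM800, Ch. III §5 exercice 5.8 (d)] [cite: Voight2021, (41.3.5)] -/
theorem XiSetup.mulVec_mem_range_funLeft_typeOf (n : ℕ) {v : ClassSet S.O → ℚ}
    (hv : v ∈ LinearMap.range (LinearMap.funLeft ℚ ℚ (typeOf S.O))) :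
    (matrix S.O n).map (Int.cast : ℤ → ℚ) *ᵥ v ∈ LinearMap.range (LinearMap.funLeft ℚ ℚ (typeOf S.O)) := by
  rw [← S.atkinLehnerInvariant_iff_mem_range_funLeft] at hv ⊢
  obtain ⟨hM, hP⟩ := hv
  refine ⟨fun q _ hq c => ?_, fun p _ hp c => ?_⟩
  · have hvW : v ∘ S.wMinus q hq = v := funext fun c => hM q inferInstance hq c
    have h := S.map_mulVec_comp_wMinus hq n v
    rw [hvW] at h
    exact (congrFun h c).symm
  · have hvW : v ∘ S.wPlus p hp = v := funext fun c => hP p inferInstance hp c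
    have h := S.map_mulVec_comp_wPlus hp n v
    rw [hvW] at h
    exact (congrFun h c).symm

/-- **The Atkin–Lehner-invariant part of the Brandt module is a Hecke submodule**: every `T(n)` maps it into itself.
[cite: VignerasLNM800, Ch. III §5 exercice 5.8 (d)] [cite: Voight2021, Cor. 41.4.10] -/
theorem XiSetup.mapsTo_toLin_matrix_range_funLeft_typeOf (n : ℕ) :
    Set.MapsTo (Matrix.toLin' ((matrix S.O n).map (Int.cast : ℤ → ℚ)))
      (LinearMap.range (LinearMap.funLeft ℚ ℚ (typeOf S.O))) (LinearMap.range (LinearMap.funLeft ℚ ℚ (typeOf S.O))) := by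
  intro v hv
  rw [SetLike.mem_coe, Matrix.toLin'_apply]
  exact S.mulVec_mem_range_funLeft_typeOf n hv

/-- The invariant part lies in every `E₊(T(q))`, `q ∣ N⁻`. [cite: VignerasLNM800, Ch. III §5 exercice 5.8 (c)] -/
theorem XiSetup.range_funLeft_typeOf_le_eigenspace_one {q : ℕ} [Fact q.Prime] (hq : q ∣ Nminus) :
    LinearMap.range (LinearMap.funLeft ℚ ℚ (typeOf S.O)) ≤
      Module.End.eigenspace (Matrix.toLin' ((matrix S.O q).map (Int.cast : ℤ → ℚ))) 1 := by
  rintro v ⟨g, rfl⟩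
  exact S.comp_typeOf_mem_eigenspace_one_of_dvd hq g

end Module

/-! ## §3 Maximal orders: `⨅_{q ∣ N⁻} E₊(T(q))` is the invariant part, of dimension `#Typ O` -/

section Maximal

variable {Nminus : ℕ} (S : XiSetup 1 Nminus) [Fintype (ClassSet S.O)] [DecidableEq (ClassSet S.O)]

/-- **For a maximal order (`N⁺ = 1`), `⨅_{q ∣ N⁻} E₊(T(q)) = {g ∘ typeOf}`**: a function is fixed by all the Brandt
matrices `T(q)`, `q ∣ N⁻` (the permutation matrices of the `W_{q⁻}`), iff it is a function of the type.
[cite: VignerasLNM800, Ch. III §5 exercice 5.8 (b)–(c)] [cite: Voight2021, Prop. 18.5.10] -/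
theorem XiSetup.iInf_eigenspace_one_eq_range_funLeft_typeOf :
    (⨅ q : ↥Nminus.primeFactors, Module.End.eigenspace (Matrix.toLin' ((matrix S.O (q : ℕ)).map (Int.cast : ℤ → ℚ))) 1) =
      LinearMap.range (LinearMap.funLeft ℚ ℚ (typeOf S.O)) := by
  ext v
  rw [Submodule.mem_iInf, ← S.atkinLehnerInvariant_iff_mem_range_funLeft]
  constructor
  · intro h
    refine ⟨fun q hf hq c => ?_, fun p _ hp c => ?_⟩
    · have hm : q ∈ Nminus.primeFactors := Nat.mem_primeFactors.mpr ⟨hf.out, hq, S.squarefree.ne_zero⟩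
      exact (S.mem_eigenspace_one_iff_of_dvd hq v).mp (h ⟨q, hm⟩) c
    · rw [S.wPlus_eq_self_of_not_dvd hp (Nat.Prime.not_dvd_one (Fact.out))]
  · rintro ⟨hM, -⟩ ⟨q, hm⟩
    haveI : Fact q.Prime := ⟨Nat.prime_of_mem_primeFactors hm⟩
    exact (S.mem_eigenspace_one_iff_of_dvd (Nat.dvd_of_mem_primeFactors hm) v).mpr fun c => hM q inferInstance _ c

/-- **`dim ⨅_{q ∣ N⁻} E₊(T(q)) = #Typ O`** for the maximal orders of the definite quaternion algebra of discriminant `N⁻`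
(at prime discriminant this is `dim E₊(T(p)) = t`, `DefiniteMaximalOrdersRamifiedInvolutionEigenspaces`).
[cite: Voight2021, Cor. 18.5.12] [cite: VignerasLNM800, Ch. III §5 exercice 5.8 (c)] -/
theorem XiSetup.finrank_iInf_eigenspace_one :
    Module.finrank ℚ
        (⨅ q : ↥Nminus.primeFactors, Module.End.eigenspace (Matrix.toLin' ((matrix S.O (q : ℕ)).map (Int.cast : ℤ → ℚ))) 1 :
          Submodule ℚ (ClassSet S.O → ℚ)) = Nat.card (TypeSet S.O) := by
  rw [S.iInf_eigenspace_one_eq_range_funLeft_typeOf, S.finrank_range_funLeft_typeOf]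

/-- The joint `+1`-eigenspace of the `T(q)`, `q ∣ N⁻`, is a Hecke submodule. [cite: VignerasLNM800, Ch. III §5 exercice 5.8 (d)] -/
theorem XiSetup.mapsTo_toLin_matrix_iInf_eigenspace_one (n : ℕ) :
    Set.MapsTo (Matrix.toLin' ((matrix S.O n).map (Int.cast : ℤ → ℚ)))
      (⨅ q : ↥Nminus.primeFactors, Module.End.eigenspace (Matrix.toLin' ((matrix S.O (q : ℕ)).map (Int.cast : ℤ → ℚ))) 1 :
        Submodule ℚ (ClassSet S.O → ℚ))
      (⨅ q : ↥Nminus.primeFactors, Module.End.eigenspace (Matrix.toLin' ((matrix S.O (q : ℕ)).map (Int.cast : ℤ → ℚ))) 1 :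
        Submodule ℚ (ClassSet S.O → ℚ)) := by
  rw [S.iInf_eigenspace_one_eq_range_funLeft_typeOf]
  exact S.mapsTo_toLin_matrix_range_funLeft_typeOf n

end Maximal

end Brandt

end Literature.NumberTheory.Automorphic
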